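import Summits.HubbardSuperconductivity.HubbardSuperconductivity.Theorems.AposterioriCapRgSsbToEvenTorusLroProjectedChordBookkeeping
import Summits.HubbardSuperconductivity.HubbardSuperconductivity.Theorems.BalabanIRBirEveryGroundStateSchur
import HarnessLib

/-!
# Route `AposterioriCapRg` — crux `SsbToEvenTorusLro` (stmt-HubbardSuperconductivity-1315),
# line `number-projected-canonical-slope`, stub `stub_projectedChord` (file 3/3: the number-projected chord)

The registered stub `stub_projectedChord` of skeleton v1 of the line: the spin-resolved one-electron WALK
(registered stub `stub_spinWalk`, taken here as the hypothesis) implies the NUMBER-PROJECTED ATTRACTIVE BLOCK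
CHORD read CANONICALLY in the summit's sector. With `H = hubbardTorus 2 L 1 U`, `W_R = R⁻⁴ Σ_a B_aᴴ B_a` the Kac
block operator, `T_h = dWaveSourceTorus L U μ h` the sourced grand-canonical torus and
`E_sec(X) = minEnergyOn (H + X) (szSector (2n) 0)`: for `κ ≤ 0`, `0 ≤ s < h`, `ρ₀L² ≤ n`, `2n ≤ L²` and any
bound `D²` on `‖(N̂ − 2n)φ‖²` over the unit ground vectors `φ` of `T_h`,

`E_sec(κW_R) − E_sec(0) ≤ κ·L²·dens_L(s)² + C·h·L² + C(1+|κ|)(D+1)`, `C = C_walk + |μ| + 2c_d`.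

Proof (Tasaki 2020 §2.1 variational bookkeeping; the projection idea of the line's idea card):
* take the spin-balanced unit ground vector `φ` of `T_h` of file 1/3 (`pc_exists_sourced_groundVector`,
  `S^z φ = (e/2)φ`, `e ∈ {0,1}`) and decompose it into its `(N↑, N↓) = (b+e, b)` components
  `φ_b = sectorProj (b+e) b φ` (`pc_sum_sectorProj_of_spinZ`); `H`, `W_R` and `N̂` conserve `(N↑, N↓)`
  (`PreservesSectors`), so every quadratic form splits over the components (`pc_quadratic_split`);
* WALK each nonzero component into `szSector (2n) 0` at cost `C_walk(1+|κ|)(|b+e−n| + |b−n|) ≤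
  C_walk(1+|κ|)(|N_b − 2n| + 1)`, `N_b = 2b+e`, and mix with the weights `p_b = ‖φ_b‖²`
  (`minEnergyOn_le_re_rayleigh`): `E_sec(κW_R) ≤ Re⟨φ,(H+κW_R)φ⟩ + C_walk(1+|κ|)(Σ_b p_b|N_b − 2n| + 1)`, and
  `Σ_b p_b|N_b − 2n| ≤ (Σ_b p_b (N_b−2n)²)^{1/2} = ‖(N̂ − 2n)φ‖ ≤ D` (Cauchy–Schwarz);
* `Re⟨φ, W_Rφ⟩ ≥ L²dens_L(s)²` (`pc_blockCoherence_ge`, file 1/3) and `κ ≤ 0`;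
  `Re⟨φ, Hφ⟩ = Re⟨φ, K_μφ⟩ + μRe⟨φ, N̂φ⟩ ≤ E₀(K_μ) + 2c_d hL² + μ⟨N̂⟩ ≤ E_sec(0) + |μ|D + 2c_d hL²`
  (`pc_re_hubbardTorusWith_le`, file 1/3; the grand-canonical floor `stub_sectorFloorGC` under the sector energy).

No definition is introduced. [folklore]
-/

noncomputable section

namespace Summit.HubbardSuperconductivity.HubbardSuperconductivity.Theorems

set_option linter.dupNamespace false

open Literature.MathematicalPhysics.QuantumLattice Literature.Probability.LatticeModels Matrix
open Literature.MathematicalPhysics.QuantumLattice.ThermodynamicLimit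
open scoped Matrix ComplexOrder ComplexConjugate Matrix.Norms.L2Operator InnerProductSpace

section Chord

variable {L : ℕ} [NeZero L]
/-! ### The mixing step -/

/-- **One component, walked and weighted.** If WALK holds with constant `C`, then for every vector `v` of the
sector `(b+e, b)` (possibly zero): `‖v‖² · E_sec(A) ≤ Re⟨v, Av⟩ + ‖v‖² · C(1+|κ|)(|b+e−n| + |b−n|)`,
`A = H + κW_R`, `E_sec(A) = minEnergyOn A (szSector (2n) 0)`. [folklore] -/
theorem pc_component_bound {U : ℝ} {R : ℕ} {C κ : ℝ} {n : ℕ}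
    (hwalk : ∀ (a b : ℕ) (χ : Fock (Orb (FermionTorus 2 L))), IsInSector a b χ → star χ ⬝ᵥ χ = 1 →
      ∃ χ' : Fock (Orb (FermionTorus 2 L)), χ' ∈ szSector (2 * n) 0 ∧ star χ' ⬝ᵥ χ' = 1 ∧
        (star χ' ⬝ᵥ (hubbardTorus 2 L 1 U + (κ : ℂ) • (((((R : ℝ) ^ 4)⁻¹ : ℝ) : ℂ) • ∑ a : TorusSite 2 L, (∑ u : Fin 2 → Fin R, localPair dWaveFormFactor L (a + fun i => ((u i : ℕ) : ZMod L)))ᴴ * (∑ u : Fin 2 → Fin R, localPair dWaveFormFactor L (a + fun i => ((u i : ℕ) : ZMod L))))) *ᵥ χ').re ≤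
          (star χ ⬝ᵥ (hubbardTorus 2 L 1 U + (κ : ℂ) • (((((R : ℝ) ^ 4)⁻¹ : ℝ) : ℂ) • ∑ a : TorusSite 2 L, (∑ u : Fin 2 → Fin R, localPair dWaveFormFactor L (a + fun i => ((u i : ℕ) : ZMod L)))ᴴ * (∑ u : Fin 2 → Fin R, localPair dWaveFormFactor L (a + fun i => ((u i : ℕ) : ZMod L))))) *ᵥ χ).re +
            C * (1 + |κ|) * (|(a : ℝ) - n| + |(b : ℝ) - n|))
    {e b : ℕ} {v : Fock (Orb (FermionTorus 2 L))} (hv : IsInSector (b + e) b v) :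
    (star v ⬝ᵥ v).re * (hubbardTorus 2 L 1 U + (κ : ℂ) • (((((R : ℝ) ^ 4)⁻¹ : ℝ) : ℂ) • ∑ a : TorusSite 2 L, (∑ u : Fin 2 → Fin R, localPair dWaveFormFactor L (a + fun i => ((u i : ℕ) : ZMod L)))ᴴ * (∑ u : Fin 2 → Fin R, localPair dWaveFormFactor L (a + fun i => ((u i : ℕ) : ZMod L))))).minEnergyOn (szSector (2 * n) 0) ≤
      (star v ⬝ᵥ ((hubbardTorus 2 L 1 U + (κ : ℂ) • (((((R : ℝ) ^ 4)⁻¹ : ℝ) : ℂ) • ∑ a : TorusSite 2 L, (∑ u : Fin 2 → Fin R, localPair dWaveFormFactor L (a + fun i => ((u i : ℕ) : ZMod L)))ᴴ * (∑ u : Fin 2 → Fin R, localPair dWaveFormFactor L (a + fun i => ((u i : ℕ) : ZMod L))))) *ᵥ v)).re +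
        (star v ⬝ᵥ v).re * (C * (1 + |κ|) * (|((b + e : ℕ) : ℝ) - n| + |(b : ℝ) - n|)) := by
  set A := hubbardTorus 2 L 1 U + (κ : ℂ) • (((((R : ℝ) ^ 4)⁻¹ : ℝ) : ℂ) • ∑ a : TorusSite 2 L, (∑ u : Fin 2 → Fin R, localPair dWaveFormFactor L (a + fun i => ((u i : ℕ) : ZMod L)))ᴴ * (∑ u : Fin 2 → Fin R, localPair dWaveFormFactor L (a + fun i => ((u i : ℕ) : ZMod L)))) with hA
  by_cases hv0 : v = 0
  · subst hv0
    simp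
  obtain ⟨c, hc0, hc1⟩ := exists_smul_unit hv0
  obtain ⟨χ', hχ'K, hχ'1, hχ'le⟩ := hwalk (b + e) b (c • v) (hv.smul c) hc1
  have hmin := minEnergyOn_le_re_rayleigh A (szSector (2 * n) 0) hχ'K hχ'1
  -- `Re⟨c v, A c v⟩ = |c|² Re⟨v, A v⟩`, `1 = |c|² ‖v‖²`
  have hsc : star (c • v) ⬝ᵥ (A *ᵥ (c • v)) = ((Complex.normSq c : ℝ) : ℂ) * (star v ⬝ᵥ (A *ᵥ v)) := by
    rw [mulVec_smul, star_smul, smul_dotProduct, dotProduct_smul, smul_smul, smul_eq_mul,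
      Complex.star_def, mul_comm (starRingEnd ℂ c) c, Complex.mul_conj]
  have hsc1 : ((Complex.normSq c : ℝ) : ℂ) * (star v ⬝ᵥ v) = 1 := by
    rw [← hc1, star_smul, smul_dotProduct, dotProduct_smul, smul_smul, smul_eq_mul, Complex.star_def,
      mul_comm (starRingEnd ℂ c) c, Complex.mul_conj]
  have hq : (Complex.normSq c : ℝ) * (star v ⬝ᵥ v).re = 1 := by
    have := congrArg Complex.re hsc1
    rwa [Complex.re_ofReal_mul, Complex.one_re] at this
  have hre : (star (c • v) ⬝ᵥ (A *ᵥ (c • v))).re = (Complex.normSq c : ℝ) * (star v ⬝ᵥ (A *ᵥ v)).re := by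
    rw [hsc, Complex.re_ofReal_mul]
  rw [hre] at hχ'le
  have hp : 0 ≤ (star v ⬝ᵥ v).re := by
    have := norm_toLp_sq v
    nlinarith [norm_nonneg (WithLp.toLp 2 v : EuclideanSpace ℂ (Finset (Orb (FermionTorus 2 L))))]
  -- multiply the chain `E_sec ≤ Re⟨χ',Aχ'⟩ ≤ |c|²Re⟨v,Av⟩ + cost` by `‖v‖²`
  have key := mul_le_mul_of_nonneg_left (hmin.trans hχ'le) hp
  have e1 : (star v ⬝ᵥ v).re * ((Complex.normSq c : ℝ) * (star v ⬝ᵥ (A *ᵥ v)).re +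
      C * (1 + |κ|) * (|((b + e : ℕ) : ℝ) - n| + |(b : ℝ) - n|)) =
      (star v ⬝ᵥ (A *ᵥ v)).re + (star v ⬝ᵥ v).re * (C * (1 + |κ|) * (|((b + e : ℕ) : ℝ) - n| + |(b : ℝ) - n|)) := by
    have : (star v ⬝ᵥ v).re * ((Complex.normSq c : ℝ) * (star v ⬝ᵥ (A *ᵥ v)).re) = (star v ⬝ᵥ (A *ᵥ v)).re := by
      rw [← mul_assoc, mul_comm ((star v ⬝ᵥ v).re), hq, one_mul]
    rw [mul_add, this]
  rw [e1] at key
  exact key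

/-! ### The registered stub -/

/-- **(CHORD) `stub_projectedChord`** — registered stub of skeleton v1 of line number-projected-canonical-slope
(crux `SsbToEvenTorusLro`, stmt-HubbardSuperconductivity-1315): the spin-resolved one-electron WALK implies the
number-projected attractive block chord read canonically,
`E_sec(H + κW_R) − E_sec(H) ≤ κ·L²·dens_L(s)² + C·h·L² + C(1+|κ|)(D+1)` on `szSector (2n) 0` for `κ ≤ 0`,
`0 ≤ s < h`, `ρ₀L² ≤ n`, `2n ≤ L²`, `D²` a bound on `‖(N̂ − 2n)φ‖²` over the unit ground vectors `φ` of the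
sourced torus. See the module docstring for the proof. [folklore] -/
theorem stub_projectedChord :
    (∀ (U : ℝ) (R : ℕ), 0 < R → ∀ ρ₀ : ℝ, 0 < ρ₀ → ∃ C : ℝ, 0 ≤ C ∧
      ∀ (L : ℕ) [NeZero L] (κ : ℝ) (a b n : ℕ) (χ : Fock (Orb (FermionTorus 2 L))),
        ρ₀ * (L : ℝ) ^ 2 ≤ (n : ℝ) → 2 * n ≤ L ^ 2 → IsInSector a b χ → star χ ⬝ᵥ χ = 1 →
        ∃ χ' : Fock (Orb (FermionTorus 2 L)), χ' ∈ szSector (2 * n) 0 ∧ star χ' ⬝ᵥ χ' = 1 ∧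
          (star χ' ⬝ᵥ (hubbardTorus 2 L 1 U + (κ : ℂ) • (((((R : ℝ) ^ 4)⁻¹ : ℝ) : ℂ) • ∑ a : TorusSite 2 L, (∑ u : Fin 2 → Fin R, localPair dWaveFormFactor L (a + fun i => ((u i : ℕ) : ZMod L)))ᴴ * (∑ u : Fin 2 → Fin R, localPair dWaveFormFactor L (a + fun i => ((u i : ℕ) : ZMod L))))) *ᵥ χ').re ≤
            (star χ ⬝ᵥ (hubbardTorus 2 L 1 U + (κ : ℂ) • (((((R : ℝ) ^ 4)⁻¹ : ℝ) : ℂ) • ∑ a : TorusSite 2 L, (∑ u : Fin 2 → Fin R, localPair dWaveFormFactor L (a + fun i => ((u i : ℕ) : ZMod L)))ᴴ * (∑ u : Fin 2 → Fin R, localPair dWaveFormFactor L (a + fun i => ((u i : ℕ) : ZMod L))))) *ᵥ χ).re +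
              C * (1 + |κ|) * (|(a : ℝ) - n| + |(b : ℝ) - n|)) →
    ∀ (U μ : ℝ) (R : ℕ), 0 < R → ∀ ρ₀ : ℝ, 0 < ρ₀ → ∃ C : ℝ, 0 ≤ C ∧
      ∀ (L : ℕ) [NeZero L] (n : ℕ) (s h κ D : ℝ),
        ρ₀ * (L : ℝ) ^ 2 ≤ (n : ℝ) → 2 * n ≤ L ^ 2 → 0 ≤ s → s < h → κ ≤ 0 → 0 ≤ D →
        (∀ φ : Fock (Orb (FermionTorus 2 L)), (dWaveSourceTorus L U μ h).IsGroundStateVector φ →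
            star φ ⬝ᵥ φ = 1 →
            (star (totalNumber *ᵥ φ - ((2 * n : ℕ) : ℂ) • φ) ⬝ᵥ (totalNumber *ᵥ φ - ((2 * n : ℕ) : ℂ) • φ)).re ≤ D ^ 2) →
        (hubbardTorus 2 L 1 U + (κ : ℂ) • (((((R : ℝ) ^ 4)⁻¹ : ℝ) : ℂ) • ∑ a : TorusSite 2 L, (∑ u : Fin 2 → Fin R, localPair dWaveFormFactor L (a + fun i => ((u i : ℕ) : ZMod L)))ᴴ * (∑ u : Fin 2 → Fin R, localPair dWaveFormFactor L (a + fun i => ((u i : ℕ) : ZMod L))))).minEnergyOn (szSector (2 * n) 0) -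
            (hubbardTorus 2 L 1 U).minEnergyOn (szSector (2 * n) 0) ≤
          κ * ((L : ℝ) ^ 2 * dWaveSourceDensity L U μ s ^ 2) + C * h * (L : ℝ) ^ 2 + C * (1 + |κ|) * (D + 1) := by
  intro hWalk U μ R hR ρ₀ hρ₀
  obtain ⟨Cw, hCw0, hCw⟩ := hWalk U R hR ρ₀ hρ₀
  set cd : ℝ := 2 * ∑ e ∈ insert (0 : Site 2) unitSteps, |dWaveFormFactor e / Real.sqrt 2| with hcd
  have hcd0 : 0 ≤ cd := by positivity
  refine ⟨Cw + |μ| + 2 * cd, by positivity, ?_⟩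
  intro L _ n s h κ D hn h2n hs hsh hκ hD hvar
  have hh : 0 ≤ h := hs.trans hsh.le
  -- scalar bookkeeping for the final assembly (done first, in a small context)
  have hμD : |μ| * D ≤ |μ| * ((1 + |κ|) * (D + 1)) := by
    refine mul_le_mul_of_nonneg_left ?_ (abs_nonneg μ)
    nlinarith [abs_nonneg κ, hD]
  have hcdh : h * (2 * (cd * (L : ℝ) ^ 2)) ≤ (Cw + |μ| + 2 * cd) * h * (L : ℝ) ^ 2 := by
    have : 0 ≤ h * (L : ℝ) ^ 2 := by positivity
    nlinarith [abs_nonneg μ, hCw0, this]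
  have hsumC : Cw * (1 + |κ|) * (D + 1) + |μ| * ((1 + |κ|) * (D + 1)) ≤
      (Cw + |μ| + 2 * cd) * (1 + |κ|) * (D + 1) := by
    have : 0 ≤ (1 + |κ|) * (D + 1) := by positivity
    nlinarith [this, hcd0]
  set W : Matrix (Finset (Orb (FermionTorus 2 L))) (Finset (Orb (FermionTorus 2 L))) ℂ :=
    (((((R : ℝ) ^ 4)⁻¹ : ℝ) : ℂ) • ∑ a : TorusSite 2 L, (∑ u : Fin 2 → Fin R, localPair dWaveFormFactor L (a + fun i => ((u i : ℕ) : ZMod L)))ᴴ * (∑ u : Fin 2 → Fin R, localPair dWaveFormFactor L (a + fun i => ((u i : ℕ) : ZMod L)))) with hWdef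
  set A := hubbardTorus 2 L 1 U + (κ : ℂ) • W with hAdef
  have hAps : PreservesSectors A := pc_preservesSectors_hubbard_add U κ R
  -- Step 1: a spin-balanced unit ground vector of the sourced torus and its components
  obtain ⟨φ, hφ, hφ1, e, he, hZ⟩ := pc_exists_sourced_groundVector L U μ h
  set v : ℕ → Fock (Orb (FermionTorus 2 L)) := fun b => sectorProj (b + e) b φ with hvdef
  have hvS : ∀ b, IsInSector (b + e) b (v b) := fun b => isInSector_sectorProj _ _ _
  set S := Finset.range (L ^ 2 + 1) with hSdef
  have hsum : ∑ b ∈ S, v b = φ := pc_sum_sectorProj_of_spinZ hZ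
  set p : ℕ → ℝ := fun b => (star (v b) ⬝ᵥ v b).re with hpdef
  have hp0 : ∀ b ∈ S, 0 ≤ p b := fun b _ => pc_re_norm_nonneg _
  have hp1 : ∑ b ∈ S, p b = 1 := by
    have h1 := pc_norm_split hvS S
    rw [hsum, hφ1] at h1
    have h2 := congrArg Complex.re h1
    rw [Complex.one_re, Complex.re_sum] at h2
    exact h2.symm
  -- Step 2: walk every component and mix
  have hwalkL : ∀ (a b : ℕ) (χ : Fock (Orb (FermionTorus 2 L))), IsInSector a b χ → star χ ⬝ᵥ χ = 1 →
      ∃ χ' : Fock (Orb (FermionTorus 2 L)), χ' ∈ szSector (2 * n) 0 ∧ star χ' ⬝ᵥ χ' = 1 ∧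
        (star χ' ⬝ᵥ (A *ᵥ χ')).re ≤ (star χ ⬝ᵥ (A *ᵥ χ)).re + Cw * (1 + |κ|) * (|(a : ℝ) - n| + |(b : ℝ) - n|) :=
    fun a b χ hχ hχ1 => hCw L κ a b n χ hn h2n hχ hχ1
  have hcomp : ∀ b ∈ S, p b * A.minEnergyOn (szSector (2 * n) 0) ≤
      (star (v b) ⬝ᵥ (A *ᵥ v b)).re + p b * (Cw * (1 + |κ|) * (|((b + e : ℕ) : ℝ) - n| + |(b : ℝ) - n|)) :=
    fun b _ => pc_component_bound hwalkL (hvS b)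
  have hmix := Finset.sum_le_sum hcomp
  rw [← Finset.sum_mul, hp1, one_mul, Finset.sum_add_distrib] at hmix
  -- `Σ_b Re⟨v_b, A v_b⟩ = Re⟨φ, Aφ⟩`
  have hsplit : ∑ b ∈ S, (star (v b) ⬝ᵥ (A *ᵥ v b)).re = (star φ ⬝ᵥ (A *ᵥ φ)).re := by
    rw [← Complex.re_sum, ← pc_quadratic_split hAps hvS S, hsum]
  rw [hsplit] at hmix
  -- the walk costs: `Σ_b p_b (|b+e-n| + |b-n|) ≤ Σ_b p_b |N_b - 2n| + 1 ≤ D + 1`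
  have hcost : ∑ b ∈ S, p b * (Cw * (1 + |κ|) * (|((b + e : ℕ) : ℝ) - n| + |(b : ℝ) - n|)) ≤
      Cw * (1 + |κ|) * (D + 1) := by
    have hK : 0 ≤ Cw * (1 + |κ|) := by positivity
    have h1 : ∀ b ∈ S, p b * (Cw * (1 + |κ|) * (|((b + e : ℕ) : ℝ) - n| + |(b : ℝ) - n|)) ≤
        Cw * (1 + |κ|) * (p b * |((b + e + b : ℕ) : ℝ) - ((2 * n : ℕ) : ℝ)| + p b) := by
      intro b hb
      have h2 := pc_abs_path_le he b n
      have h3 : ((2 * b + e : ℕ) : ℝ) - 2 * n = ((b + e + b : ℕ) : ℝ) - ((2 * n : ℕ) : ℝ) := by push_cast; ring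
      rw [h3] at h2
      have := mul_le_mul_of_nonneg_left h2 (mul_nonneg (hp0 b hb) hK)
      linarith only [this]
    refine (Finset.sum_le_sum h1).trans ?_
    rw [← Finset.mul_sum, Finset.sum_add_distrib, hp1]
    refine mul_le_mul_of_nonneg_left ?_ hK
    have hcs := pc_weighted_cs S (y := fun b => ((b + e + b : ℕ) : ℝ) - ((2 * n : ℕ) : ℝ)) hp0 hp1
    have hnorm := pc_numDev_norm hvS S (2 * n)
    rw [hsum] at hnorm
    have hvarφ := hvar φ hφ hφ1
    rw [hnorm] at hvarφ
    have hsq : Real.sqrt (∑ b ∈ S, p b * (((b + e + b : ℕ) : ℝ) - ((2 * n : ℕ) : ℝ)) ^ 2) ≤ D := by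
      rw [← Real.sqrt_sq hD]
      exact Real.sqrt_le_sqrt (by exact_mod_cast hvarφ)
    linarith only [hcs, hsq]
  -- Step 3: `Re⟨φ, Aφ⟩ ≤ E_sec(H) + |μ| D + 2 cd h L² + κ L² dens²`
  have hAφ : (star φ ⬝ᵥ (A *ᵥ φ)).re =
      (star φ ⬝ᵥ (hubbardTorus 2 L 1 U *ᵥ φ)).re + κ * (star φ ⬝ᵥ (W *ᵥ φ)).re := by
    rw [hAdef, add_mulVec, dotProduct_add, Complex.add_re, smul_mulVec, dotProduct_smul, smul_eq_mul,
      Complex.re_ofReal_mul]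
  have hWφ : κ * (star φ ⬝ᵥ (W *ᵥ φ)).re ≤ κ * ((L : ℝ) ^ 2 * dWaveSourceDensity L U μ s ^ 2) :=
    mul_le_mul_of_nonpos_left (pc_blockCoherence_ge hR hφ hφ1 hs hsh) hκ
  -- `H = K_μ + μ N̂`
  have hHφ : (star φ ⬝ᵥ (hubbardTorus 2 L 1 U *ᵥ φ)).re =
      (star φ ⬝ᵥ (hubbardTorusWith 2 L 1 U μ *ᵥ φ)).re + μ * (star φ ⬝ᵥ (totalNumber *ᵥ φ)).re := by
    rw [hubbardTorusWith_eq, sub_mulVec, dotProduct_sub, Complex.sub_re, smul_mulVec, dotProduct_smul,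
      smul_eq_mul, Complex.re_ofReal_mul]
    ring
  have hKφ := pc_re_hubbardTorusWith_le (L := L) (U := U) (μ := μ) hh hφ hφ1
  rw [← hcd] at hKφ
  -- the grand-canonical floor under the sector energy (needs a nonzero vector of the sector: walk one component)
  have hex : ∃ χ : Fock (Orb (FermionTorus 2 L)), χ ∈ szSector (2 * n) 0 ∧ χ ≠ 0 := by
    obtain ⟨b₀, -, hb₀⟩ : ∃ b₀ ∈ S, v b₀ ≠ 0 := by
      by_contra hall
      push Not at hall
      have : φ = 0 := by rw [← hsum]; exact Finset.sum_eq_zero hall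
      exact hφ.1 this
    obtain ⟨c, -, hc1⟩ := exists_smul_unit hb₀
    obtain ⟨χ', hχ'K, hχ'1, -⟩ := hwalkL (b₀ + e) b₀ (c • v b₀) ((hvS b₀).smul c) hc1
    refine ⟨χ', hχ'K, fun h0 => ?_⟩
    rw [h0, dotProduct_zero] at hχ'1
    exact zero_ne_one hχ'1
  have hfloor := pc_gcFloor U μ hex
  -- `μ (Re⟨φ, N̂φ⟩ − 2n) ≤ |μ| D`
  have hNφ : μ * (star φ ⬝ᵥ (totalNumber *ᵥ φ)).re - μ * ((2 * n : ℕ) : ℝ) ≤ |μ| * D := by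
    set u := totalNumber *ᵥ φ - ((2 * n : ℕ) : ℂ) • φ with hu
    have hu1 : μ * (star φ ⬝ᵥ (totalNumber *ᵥ φ)).re - μ * ((2 * n : ℕ) : ℝ) = μ * (star φ ⬝ᵥ u).re := by
      rw [hu, dotProduct_sub, Complex.sub_re, dotProduct_smul, hφ1, smul_eq_mul, mul_one, Complex.natCast_re]
      ring
    rw [hu1]
    have hcs := norm_star_dotProduct_le_norm_toLp φ u
    have hφn : ‖(WithLp.toLp 2 φ : EuclideanSpace ℂ (Finset (Orb (FermionTorus 2 L))))‖ = 1 := by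
      rw [pc_norm_toLp_eq_sqrt, hφ1, Complex.one_re, Real.sqrt_one]
    have hun : ‖(WithLp.toLp 2 u : EuclideanSpace ℂ (Finset (Orb (FermionTorus 2 L))))‖ ≤ D := by
      rw [pc_norm_toLp_eq_sqrt, ← Real.sqrt_sq hD]
      exact Real.sqrt_le_sqrt (hvar φ hφ hφ1)
    rw [hφn, one_mul] at hcs
    have h1 : (star φ ⬝ᵥ u).re ≤ D := ((Complex.re_le_norm _).trans hcs).trans hun
    have h2 : -D ≤ (star φ ⬝ᵥ u).re := by
      have := (Complex.neg_re _ ▸ Complex.re_le_norm (-(star φ ⬝ᵥ u)))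
      rw [norm_neg] at this
      linarith only [this, hcs.trans hun]
    rcases le_or_gt 0 μ with hμ | hμ
    · rw [abs_of_nonneg hμ]; nlinarith only [hμ, h1, h2, hD]
    · rw [abs_of_neg hμ]; nlinarith only [hμ, h1, h2, hD]
  -- Step 4: assemble — make the big atoms opaque before the final linear arithmetic
  generalize (star φ ⬝ᵥ (A *ᵥ φ)).re = rA at hmix hAφ
  generalize (star φ ⬝ᵥ (W *ᵥ φ)).re = rW at hAφ hWφ
  generalize (star φ ⬝ᵥ (hubbardTorus 2 L 1 U *ᵥ φ)).re = rH at hAφ hHφ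
  generalize (star φ ⬝ᵥ (hubbardTorusWith 2 L 1 U μ *ᵥ φ)).re = rK at hHφ hKφ
  generalize (star φ ⬝ᵥ (totalNumber *ᵥ φ)).re = rN at hHφ hNφ
  generalize (hubbardTorusWith 2 L 1 U μ).groundEnergy = E₀ at hKφ hfloor
  generalize A.minEnergyOn (szSector (2 * n) 0) = EA at hmix ⊢
  generalize (hubbardTorus 2 L 1 U).minEnergyOn (szSector (2 * n) 0) = EH at hfloor ⊢
  generalize (∑ b ∈ S, p b * (Cw * (1 + |κ|) * (|((b + e : ℕ) : ℝ) - n| + |(b : ℝ) - n|))) = cost at hmix hcost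
  generalize (L : ℝ) ^ 2 * dWaveSourceDensity L U μ s ^ 2 = dd at hWφ ⊢
  generalize (L : ℝ) ^ 2 = L2 at hKφ hcdh ⊢
  linarith only [hmix, hcost, hAφ, hWφ, hHφ, hKφ, hfloor, hNφ, hμD, hcdh, hsumC]

end Chord

end Summit.HubbardSuperconductivity.HubbardSuperconductivity.Theorems

end
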